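/-
Copyright (c) 2026 the pub-hodgecm-mathlib formalisation cell (harness21).  Prover seat hodgecm-mathlib-K2E3-p37 (g4), Track B «K2-LIT» ∕ hLiu418
#184♮, Road I v3, unit U5 «THE CLOSE», FACE-D₀ rows `hfin₁ hfin₂`: THE RANK-ONE CLASS LETTER `hloc′` AND SIGN LETTER `hsign′` OF ONE SIDE FROM A SINGLE
GLOBAL-GRAM LETTER — the converse of ★ U2c-glob `K2LiuRankOneOrbitUniformity.lineGram_transport_of_locF_eq_of_totallyPositive`.  THEOREMS ONLY.
-/
import Summits.HodgeConjecture.HodgeConjecture.Theorems.K2LiuRankOneOrbitUniformity     -- ★ U2c `locF_eq_of_eq_mul_conjLocal` (+ ★ `K2LiuRankOneLineGram`, ★ `F0LD1LineClassHasse`, ★ Lit `CMFieldHasseNorm`)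
import Literature.NumberTheory.NumberFields.QuarticCMFieldEvenQuarticPresentation       -- ★ Lit `IsCMField.ringHom_real_lt_zero_of_sq_eq` (`δ²` is negative under every `ρ : L⁺ →+* ℝ`)
import HarnessLib

/-!
# K2_Liu road (hLiu418 = stmt-HodgeConjecture-24832), U5 «THE CLOSE», FACE-D₀ rows `hfin₁ hfin₂`:
# BOTH RANK-ONE LETTERS OF ONE SIDE FROM THE GLOBAL-GRAM LETTER

Cell `pub/hodgecm-mathlib` (D-0151), Track B, build stream 29; helper lane `--supports stmt-HodgeConjecture-24832 --as helper`, count-neutral; closes no socket.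
THEOREMS ONLY (no `def`, no `instance`, no notation, no named-fact hypothesis, no `sorry`).

THE FACE.  ★ p864827 `K2LiuRigidityRowsOfRecord.rigidityRows_of_rowLetters` (FACE-D₀ rows assembler; RULING M-160i: ED. 2 keys the letters on `−β`) takes,
for each side `T ∈ {T₁ (residue), T₂ (theta)}`, TWO by-value letters about the surviving rank-one indices `β = b • ū ⊗ u` (`b ∈ (L⁺)^×`, `u : Fin 2 → L`
with a coordinate `1`): the CLASS letter `hloc′` «`locF b w = locF a′ w` at every finite place `w` of `L⁺`» and the SIGN letter `hsign′` «`0 < ρ(b · a′⁻¹)`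
for every `ρ : L⁺ →+* ℝ`» ([Liu2021, Def. 4.11–4.12]: the collection of `⟨b⟩` is that of `⟨a′⟩` and `b ∕ a′` is totally positive).  Together they say
(Hasse, ★ U2c-glob) that `b = a′ · ē e` is a NORM TIMES `a′`, i.e. `β` is a GLOBAL Gram matrix of the hermitian line `⟨a′⟩`.

THIS FILE proves the converse reading, which is the single consumer interface of the GLOBAL route to these letters (route (B3) of the FACE-D₀ ledger
census, K2 bus 2026-09-05T03:06Z; U1 desk «=» 03:06:53Z): if every surviving rank-one index is a global Gram of `⟨a′⟩` — ONE letter, in scalar form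
«`∃ e : L, b = a′ · (ē e)` in `L`» or in matrix form «`∃ v : Fin 2 → L, b • ū ⊗ u = a′ • v̄ ⊗ v`» — then BOTH `hloc′` (all finite `w`) AND `hsign′` (all `ρ`)
hold, in the exact binder shapes of ★ p864827 :137–:156 (`∀ w b u, (∃ k, u k = 1) → ‹survives› → locF …` ∕ `∀ b u, (∃ k, u k = 1) → ‹survives› → ∀ ρ, 0 < …`),
for an ARBITRARY survival predicate `Surv b u` (at the tie: `fun b u => ∃ x h, fourierCoeffDelta … (dict′ (b • ū ⊗ u)) (T x) h ≠ 0`, either keying).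
* §1 arithmetic of the CM extension `L ∕ L⁺ = L⁺(δ)`, `δ² = imagUnitSq L` totally negative:
  **`locF_eq_of_globalGram`** — `b = a′ · (ē e)` in `L` ⇒ `locF b w = locF a′ w` at every finite `w` (★ U2c `locF_eq_of_eq_mul_conjLocal` at `z := e ⊗ 1 ∈ L ⊗ L⁺_w`);
  **`pos_of_globalGram`** — `b = a′ · (ē e)` ⇒ `0 < ρ(b · a′⁻¹)` for every `ρ : L⁺ →+* ℝ` (`ē e = x² − δ² y²`, ★ Lit `IsCMField.exists_eq_mul_complexConj_iff_exists_sq_sub_mul_sq`,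
  and `ρ(δ²) < 0`, ★ Lit `IsCMField.ringHom_real_lt_zero_of_sq_eq`);
  **`globalGram_of_matrix`** — the matrix form ⇒ the scalar form (★ `K2LiuRankOneLineGram.eq_mul_conj_mul_self_of_smul_vecMulVec_eq`, contracting with `e_k`).
* §2 the letter readers **`hloc_hsign_of_globalGram`** (scalar letter) and **`hloc_hsign_of_globalGramMatrix`** (matrix letter): `hloc′ ∧ hsign′` for the side.
What this file does NOT do: produce the global-Gram letter for either side (theta side: the global unfolding of the doubled line theta lift's Fourier
coefficient, route (B3); residue side: no producer — U1 desk «PROMOTE» 03:06:53Z).  HONEST LABEL: HC_CM is proved only modulo the 7 printed citations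
(2 remaining named inputs: hLiu418 = stmt-HodgeConjecture-24832, h413 = stmt-HodgeConjecture-24833) until rung 0 closes; this file moves no counter.

References: [Liu2021] Y. Liu, Camb. J. Math. 9 (2021) = arXiv:2102.11518, Def. 4.11–4.12 (l. 2088–2108), App. D §D.1 Step 1 footnote (l. 5215);
[Omeara1963] O. T. O'Meara, *Introduction to Quadratic Forms*, §63B (63:10), §65D Thm. 65:23; [Scharlau1985HermitianForms] W. Scharlau, Grundlehren 270, Ch. 10 §1;
[MilneCM2006] J. S. Milne, *Complex Multiplication*, Ch. II §9 proof of Lemma 9.14; [KudlaRallis1994] S. Kudla, S. Rallis, Ann. of Math. 140 (1994) §3.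
-/

set_option autoImplicit false
set_option linter.dupNamespace false -- the mandated namespace repeats `HodgeConjecture.HodgeConjecture`

noncomputable section

open NumberField IsDedekindDomain
open scoped Matrix
open Literature.NumberTheory.Automorphic Literature.NumberTheory.Automorphic.UnitaryGroup
open Literature.NumberTheory.Automorphic.Liu2021.Def411WeilCarriers
open Literature.NumberTheory.GelbartRogawski1991.UnitaryDualPair
open Literature.NumberTheory.NumberFields
open Summit.HodgeConjecture.HodgeConjecture.Cruxes.HLiu418.K2LiuRankOneLineGram (eq_mul_conj_mul_self_of_smul_vecMulVec_eq)
open Summit.HodgeConjecture.HodgeConjecture.Cruxes.HLiu418.K2LiuRankOneOrbitUniformity (locF_eq_of_eq_mul_conjLocal)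

namespace Summit.HodgeConjecture.HodgeConjecture.Cruxes.HLiu418.K2LiuRankOneLettersOfGlobalGram

variable (L : Type) [Field L] [NumberField L] [IsCMField L]

/-! ## §1 Arithmetic of `L ∕ L⁺`: a norm times `a′` has the class of `a′` everywhere and a totally positive ratio -/

section Arithmetic

/-- **CLASS LETTER FROM A GLOBAL GRAM**: if `b = a′ · (ē e)` in `L` (`e ∈ L`), then the hermitian lines `⟨b⟩`, `⟨a′⟩` have the same class at every
finite place `w` of `L⁺`: `locF b w = locF a′ w` in `L⁺_w^× ∕ Nm` — ★ U2c `locF_eq_of_eq_mul_conjLocal` at the local image `z = e ⊗ 1 ∈ L ⊗ L⁺_w` of the global `e`.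
[cite: Liu2021, Def. 4.11–4.12 (l. 2088–2108)] [cite: Omeara1963, §63B (63:10)] -/
theorem locF_eq_of_globalGram (a' b : (↥(maximalRealSubfield L))ˣ) {e : L}
    (h : algebraMap (↥(maximalRealSubfield L)) L b =
      algebraMap (↥(maximalRealSubfield L)) L a' * (IsCMField.complexConj L e * e))
    (w : HeightOneSpectrum (𝓞 ↥(maximalRealSubfield L))) :
    locF (↥(maximalRealSubfield L)) (imagUnitSq L) b w = locF (↥(maximalRealSubfield L)) (imagUnitSq L) a' w := by
  refine locF_eq_of_eq_mul_conjLocal L a' b w (algebraMap L (LocalRing L w) e) ?_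
  have hc : ∀ x : ↥(maximalRealSubfield L),
      algebraMap (↥(maximalRealSubfield L)) (w.adicCompletion ↥(maximalRealSubfield L)) x = (x : w.adicCompletion ↥(maximalRealSubfield L)) :=
    fun _ => rfl
  rw [hc, hc, toLocalRing_coe, toLocalRing_coe, h, map_mul, map_mul, conjLocal_algebraMap]
  ring

/-- **SIGN LETTER FROM A GLOBAL GRAM**: if `b = a′ · (ē e)` in `L`, then `b · a′⁻¹` is totally positive: `0 < ρ(b · a′⁻¹)` for every ring homomorphism
`ρ : L⁺ →+* ℝ`.  Indeed `b · a′⁻¹ = e ē = x² − δ² y²` with `x, y ∈ L⁺` (★ Lit `IsCMField.exists_eq_mul_complexConj_iff_exists_sq_sub_mul_sq`), `δ²` is negative under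
`ρ` (★ Lit `IsCMField.ringHom_real_lt_zero_of_sq_eq`), and `(x, y) ≠ 0` since `b ≠ 0`. [cite: MilneCM2006, Ch. II §9, proof of Lemma 9.14 (p. 79)]
[cite: Liu2021, Def. 4.12 (l. 2102–2108)] -/
theorem pos_of_globalGram (a' b : (↥(maximalRealSubfield L))ˣ) {e : L}
    (h : algebraMap (↥(maximalRealSubfield L)) L b =
      algebraMap (↥(maximalRealSubfield L)) L a' * (IsCMField.complexConj L e * e))
    (ρ : ↥(maximalRealSubfield L) →+* ℝ) :
    0 < ρ ((b : ↥(maximalRealSubfield L)) * ((a' : ↥(maximalRealSubfield L)))⁻¹) := by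
  have ha' : algebraMap (↥(maximalRealSubfield L)) L (a' : ↥(maximalRealSubfield L)) ≠ 0 := (map_ne_zero _).2 a'.ne_zero
  -- the ratio is a norm from `L`
  have hq : algebraMap (↥(maximalRealSubfield L)) L ((b : ↥(maximalRealSubfield L)) * ((a' : ↥(maximalRealSubfield L)))⁻¹) =
      e * IsCMField.complexConj L e := by
    rw [map_mul, map_inv₀, h, mul_comm (IsCMField.complexConj L e) e, mul_comm, ← mul_assoc, inv_mul_cancel₀ ha', one_mul]
  have hsq : imagUnit L ^ 2 = algebraMap (↥(maximalRealSubfield L)) L (imagUnitSq L) := by rw [sq, imagUnit_mul_self]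
  obtain ⟨x, y, hxy⟩ :=
    (IsCMField.exists_eq_mul_complexConj_iff_exists_sq_sub_mul_sq (complexConj_imagUnit L) (imagUnit_ne_zero L) hsq _).1 ⟨e, hq⟩
  have hθ : ρ (imagUnitSq L) < 0 := IsCMField.ringHom_real_lt_zero_of_sq_eq L (complexConj_imagUnit L) (imagUnit_ne_zero L) hsq ρ
  have hne : (b : ↥(maximalRealSubfield L)) * ((a' : ↥(maximalRealSubfield L)))⁻¹ ≠ 0 := mul_ne_zero b.ne_zero (inv_ne_zero a'.ne_zero)
  rw [← hxy, map_sub, map_mul, map_pow, map_pow]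
  have hy2 : 0 ≤ ρ y ^ 2 := sq_nonneg _
  rcases eq_or_ne x 0 with rfl | hx
  · -- `x = 0`: then `y ≠ 0` and the value is `−ρ(δ²) · ρ(y)² > 0`
    have hy : y ≠ 0 := by
      rintro rfl
      apply hne
      rw [← hxy]
      ring
    have hy' : 0 < ρ y ^ 2 := by
      have hy0 : ρ y ≠ 0 := (map_ne_zero ρ).2 hy
      positivity
    nlinarith [mul_pos (neg_pos.2 hθ) hy']
  · have hx' : 0 < ρ x ^ 2 := by
      have hx0 : ρ x ≠ 0 := (map_ne_zero ρ).2 hx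
      positivity
    nlinarith [mul_nonneg (neg_pos.2 hθ).le hy2]

/-- **MATRIX FORM ⇒ SCALAR FORM of the global-Gram letter**: if `b • ū ⊗ u = a′ • v̄ ⊗ v` with `u k = 1`, then `b = a′ · (ē e)` for `e := v k`
(contract both Gram matrices with `e_k`: ★ `eq_mul_conj_mul_self_of_smul_vecMulVec_eq`). [cite: Scharlau1985HermitianForms, Ch. 10 §1] -/
theorem globalGram_of_matrix (a' b : (↥(maximalRealSubfield L))ˣ) {u v : Fin 2 → L} (hu : ∃ k, u k = 1)
    (h : algebraMap (↥(maximalRealSubfield L)) L b • Matrix.vecMulVec (⇑(IsCMField.complexConj L) ∘ u) u =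
      algebraMap (↥(maximalRealSubfield L)) L a' • Matrix.vecMulVec (⇑(IsCMField.complexConj L) ∘ v) v) :
    ∃ e : L, algebraMap (↥(maximalRealSubfield L)) L b =
      algebraMap (↥(maximalRealSubfield L)) L a' * (IsCMField.complexConj L e * e) := by
  obtain ⟨k, hk⟩ := hu
  exact ⟨v ⬝ᵥ Pi.single k 1,
    eq_mul_conj_mul_self_of_smul_vecMulVec_eq (IsCMField.complexConj L : L →+* L) h.symm (Pi.single k 1) (by rw [dotProduct_single, mul_one, hk])⟩

end Arithmetic

/-! ## §2 The letter readers: `hloc′ ∧ hsign′` of one side from its global-Gram letter -/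

section Letters

/-- **BOTH RANK-ONE LETTERS OF ONE SIDE FROM THE GLOBAL-GRAM LETTER (scalar form).**  For ANY survival predicate `Surv b u` of the rank-one indices
`b • ū ⊗ u` (at the FACE-D₀ tie: «the Fourier coefficient of some `T x` at `dict′(b • ū ⊗ u)` is non-zero at some `h`», side `T`, either keying): if every
surviving index with a coordinate `u k = 1` has `b = a′ · (ē e)` for some `e ∈ L`, then the side's CLASS letter (`∀ w b u, … → locF b w = locF a′ w`) and SIGN
letter (`∀ b u, … → ∀ ρ, 0 < ρ(b · a′⁻¹)`) both hold — the binder shapes of ★ p864827 `rigidityRows_of_rowLetters` :137–:156.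
[cite: Liu2021, Def. 4.11–4.12 (l. 2088–2108)] [cite: KudlaRallis1994, §3] [cite: Omeara1963, §63B (63:10)] -/
theorem hloc_hsign_of_globalGram (a' : (↥(maximalRealSubfield L))ˣ) (Surv : (↥(maximalRealSubfield L))ˣ → (Fin 2 → L) → Prop)
    (hglob : ∀ (b : (↥(maximalRealSubfield L))ˣ) (u : Fin 2 → L), (∃ k, u k = 1) → Surv b u →
      ∃ e : L, algebraMap (↥(maximalRealSubfield L)) L b =
        algebraMap (↥(maximalRealSubfield L)) L a' * (IsCMField.complexConj L e * e)) :
    (∀ (w : HeightOneSpectrum (𝓞 ↥(maximalRealSubfield L))) (b : (↥(maximalRealSubfield L))ˣ) (u : Fin 2 → L), (∃ k, u k = 1) → Surv b u →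
        locF (↥(maximalRealSubfield L)) (imagUnitSq L) b w = locF (↥(maximalRealSubfield L)) (imagUnitSq L) a' w) ∧
      (∀ (b : (↥(maximalRealSubfield L))ˣ) (u : Fin 2 → L), (∃ k, u k = 1) → Surv b u →
        ∀ ρ : ↥(maximalRealSubfield L) →+* ℝ, 0 < ρ ((b : ↥(maximalRealSubfield L)) * ((a' : ↥(maximalRealSubfield L)))⁻¹)) :=
  ⟨fun w b u hu hs => (hglob b u hu hs).elim fun _ he => locF_eq_of_globalGram L a' b he w,
    fun b u hu hs ρ => (hglob b u hu hs).elim fun _ he => pos_of_globalGram L a' b he ρ⟩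

/-- **BOTH RANK-ONE LETTERS OF ONE SIDE FROM THE GLOBAL-GRAM LETTER (matrix form)** — the literal output of a global unfolding: «every surviving rank-one
index `b • ū ⊗ u` IS a Gram matrix `a′ • v̄ ⊗ v` of a pair of vectors `v : Fin 2 → L` in the hermitian line `⟨a′⟩`».
[cite: KudlaRallis1994, §3] [cite: Liu2021, Def. 4.11–4.12 (l. 2088–2108)] [cite: Scharlau1985HermitianForms, Ch. 10 §1] -/
theorem hloc_hsign_of_globalGramMatrix (a' : (↥(maximalRealSubfield L))ˣ) (Surv : (↥(maximalRealSubfield L))ˣ → (Fin 2 → L) → Prop)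
    (hgram : ∀ (b : (↥(maximalRealSubfield L))ˣ) (u : Fin 2 → L), (∃ k, u k = 1) → Surv b u →
      ∃ v : Fin 2 → L, algebraMap (↥(maximalRealSubfield L)) L b • Matrix.vecMulVec (⇑(IsCMField.complexConj L) ∘ u) u =
        algebraMap (↥(maximalRealSubfield L)) L a' • Matrix.vecMulVec (⇑(IsCMField.complexConj L) ∘ v) v) :
    (∀ (w : HeightOneSpectrum (𝓞 ↥(maximalRealSubfield L))) (b : (↥(maximalRealSubfield L))ˣ) (u : Fin 2 → L), (∃ k, u k = 1) → Surv b u →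
        locF (↥(maximalRealSubfield L)) (imagUnitSq L) b w = locF (↥(maximalRealSubfield L)) (imagUnitSq L) a' w) ∧
      (∀ (b : (↥(maximalRealSubfield L))ˣ) (u : Fin 2 → L), (∃ k, u k = 1) → Surv b u →
        ∀ ρ : ↥(maximalRealSubfield L) →+* ℝ, 0 < ρ ((b : ↥(maximalRealSubfield L)) * ((a' : ↥(maximalRealSubfield L)))⁻¹)) :=
  hloc_hsign_of_globalGram L a' Surv fun b u hu hs => (hgram b u hu hs).elim fun _ hv => globalGram_of_matrix L a' b hu hv

end Letters

end Summit.HodgeConjecture.HodgeConjecture.Cruxes.HLiu418.K2LiuRankOneLettersOfGlobalGram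

end
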